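import Summits.AtomisticToContinuum.Crystallization.Theorems.FreeSplittingCertificatesStrictSplittingRuleP1CellMomentsReal
import Mathlib.MeasureTheory.Integral.Layercake

/-!
# `StrictSplittingRule` (stmt-AtomisticToContinuum-12560): THIRD-order moments of the corner simplex by the layer-cake identity — `∫_K λ₀³ = 1/120`, `∫_K λ₀²λ₁ = 1/360`, `∫_K λ₀λ₁λ₂ = 1/720` (P1 interpolant object, part 26)

Route `FreeSplittingCertificates`, crux r3 `StrictSplittingRule` (H12⋆ = `stub_coreJointCoercive`), unit b2b-freesplit-B gen 27.
VALUE = the input the radial per-site domination TAIL lemma cannot do without (HOME FAR-LEMMA-SPEC §20 (c)): the exact second-moment MATRIX of a hat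
function is `Σ_T Σ_{j,k}(∫_Tλ_qλ_jλ_k)e_je_kᵀ`, i.e. it needs the third-order simplex moments.  Part 23's cube method cannot reach them (every cubic
test function on the cube is degenerate modulo `Σλ = 1`); what does is the LAYER-CAKE identity: on the corner simplex `K`,
`K ∩ {λ₀ ≥ s} = (1 − s)•K` for `0 ≤ s < 1` (`p1RefCell_inter_bary_ge`), so `vol(K ∩ {λ₀ ≥ s}) = (1−s)³/6` (`Measure.addHaar_smul`), and Mathlib's
layer-cake formula (`lintegral_comp_eq_lintegral_meas_le_mul` with `g = 3t²`) gives **`∫_K λ₀³ = ∫₀¹ 3t²(1−t)³/6 dt = 1/120`**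
(`setIntegral_p1Bary_cube_corner`).  The reductions `∫λ₀²·(Σλ) = ∫λ₀² = 1/60`, `∫λ₀λ₁·(Σλ) = 1/120` (parts 21–23) and four symmetry transports
(parts 20–22) then give **`∫_K λ₀²λ₁ = 1/360`** and **`∫_K λ₀λ₁λ₂ = 1/720`** (`setIntegral_p1Bary_sq_mul_corner`, `setIntegral_p1Bary_triple_corner`) —
Dirichlet's values `|K|·3!α!/(|α|+3)!`.  NOT a proof of H12⋆, NOT summit progress.  [folklore: Dirichlet simplex integrals]
-/

noncomputable section

open Set Function Metric MeasureTheory Filter Topology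
open scoped BigOperators NNReal ENNReal Pointwise

namespace Summit.AtomisticToContinuum.Crystallization.Theorems.StrictSplittingRuleBirth

/-! ## Membership in the corner simplex in coordinates -/

/-- `p ∈ K ↔ p₀, p₁, p₂ ≥ 0 ∧ p₀ + p₁ + p₂ ≤ 1`. -/
theorem mem_p1RefCell_corner_iff (p : Fin 3 → ℝ) :
    p ∈ p1RefCell true 0 ↔ 0 ≤ p 0 ∧ 0 ≤ p 1 ∧ 0 ≤ p 2 ∧ p 0 + p 1 + p 2 ≤ 1 := by
  constructor
  · intro hp
    have h0 := hp 0; have h1 := hp 1; have h2 := hp 2; have h3 := hp 3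
    simp only [p1Bary_corner] at h0 h1 h2 h3
    simp at h0 h1 h2 h3
    exact ⟨h1, h2, h3, by linarith⟩
  · rintro ⟨h0, h1, h2, hs⟩ m
    rw [p1Bary_corner]
    fin_cases m <;> simp <;> linarith

/-! ## The super-level sets of `λ₀` are scaled copies of `K` -/

/-- **`K ∩ {λ₀ ≥ s} = (1 − s)•K`** for `0 ≤ s < 1` (scaling about the vertex `0`, where `λ₀ = 1`). -/
theorem p1RefCell_inter_bary_ge {s : ℝ} (hs0 : 0 ≤ s) (hs1 : s < 1) :
    p1RefCell true 0 ∩ {p | s ≤ p1Bary true 0 0 p} = (1 - s) • p1RefCell true 0 := by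
  have hc : 0 < 1 - s := by linarith
  have hci : 0 ≤ (1 - s)⁻¹ := inv_nonneg.2 hc.le
  ext p
  simp only [mem_inter_iff, mem_setOf_eq, Set.mem_smul_set]
  constructor
  · rintro ⟨hp, hsp⟩
    rw [mem_p1RefCell_corner_iff] at hp
    obtain ⟨h0, h1, h2, hsum⟩ := hp
    rw [p1Bary_corner] at hsp; simp at hsp
    refine ⟨(1 - s)⁻¹ • p, ?_, ?_⟩
    · rw [mem_p1RefCell_corner_iff]
      simp only [Pi.smul_apply, smul_eq_mul]
      refine ⟨mul_nonneg hci h0, mul_nonneg hci h1, mul_nonneg hci h2, ?_⟩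
      rw [← mul_add, ← mul_add, inv_mul_le_iff₀ hc]
      linarith
    · ext i
      simp only [Pi.smul_apply, smul_eq_mul]
      rw [← mul_assoc, mul_inv_cancel₀ hc.ne', one_mul]
  · rintro ⟨q, hq, rfl⟩
    rw [mem_p1RefCell_corner_iff] at hq
    obtain ⟨h0, h1, h2, hsum⟩ := hq
    refine ⟨?_, ?_⟩
    · rw [mem_p1RefCell_corner_iff]
      simp only [Pi.smul_apply, smul_eq_mul]
      refine ⟨mul_nonneg hc.le h0, mul_nonneg hc.le h1, mul_nonneg hc.le h2, ?_⟩
      nlinarith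
    · rw [p1Bary_corner]; simp only [if_true, Pi.smul_apply, smul_eq_mul]
      nlinarith

/-- For `t ≥ 1` the super-level set is contained in `{0}`. -/
theorem p1RefCell_inter_bary_ge_subset_zero {t : ℝ} (ht : 1 ≤ t) :
    p1RefCell true 0 ∩ {p | t ≤ p1Bary true 0 0 p} ⊆ {0} := by
  rintro p ⟨hp, htp⟩
  rw [mem_p1RefCell_corner_iff] at hp
  simp only [mem_setOf_eq, p1Bary_corner] at htp; simp at htp
  obtain ⟨h0, h1, h2, -⟩ := hp
  have e0 : p 0 = 0 := by linarith
  have e1 : p 1 = 0 := by linarith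
  have e2 : p 2 = 0 := by linarith
  rw [mem_singleton_iff]; ext i; fin_cases i <;> simp [e0, e1, e2]

/-- **Volume of the super-level sets**: `vol(K ∩ {λ₀ ≥ t}) = (1−t)³/6` for `0 ≤ t ≤ 1`. -/
theorem volume_p1RefCell_inter_bary_ge {t : ℝ} (ht0 : 0 ≤ t) (ht1 : t ≤ 1) :
    volume (p1RefCell true 0 ∩ {p | t ≤ p1Bary true 0 0 p}) = ENNReal.ofReal ((1 - t) ^ 3 / 6) := by
  rcases lt_or_eq_of_le ht1 with hlt | rfl
  · rw [p1RefCell_inter_bary_ge ht0 hlt, Measure.addHaar_smul_of_nonneg volume (by linarith) (p1RefCell true 0), volume_p1RefCell]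
    simp only [Module.finrank_fintype_fun_eq_card, Fintype.card_fin]
    rw [div_eq_mul_inv, ENNReal.ofReal_mul (by positivity), ENNReal.ofReal_inv_of_pos (by norm_num : (0:ℝ) < 6)]
    norm_num
  · have h0 : volume (p1RefCell true 0 ∩ {p | (1 : ℝ) ≤ p1Bary true 0 0 p}) = 0 :=
      measure_mono_null (p1RefCell_inter_bary_ge_subset_zero le_rfl) (measure_singleton _)
    rw [h0]; norm_num

/-- For `t > 1` the super-level set is null. -/
theorem volume_p1RefCell_inter_bary_ge_of_one_lt {t : ℝ} (ht : 1 < t) :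
    volume (p1RefCell true 0 ∩ {p | t ≤ p1Bary true 0 0 p}) = 0 :=
  measure_mono_null (p1RefCell_inter_bary_ge_subset_zero ht.le) (measure_singleton _)

/-- The corner simplex is compact (closed subset of the unit cube). -/
theorem isCompact_p1RefCell_corner : IsCompact (p1RefCell true 0) := by
  refine (isCompact_Icc (a := (0 : Fin 3 → ℝ)) (b := 1)).of_isClosed_subset (isClosed_p1RefCell true 0) fun p hp => ?_
  exact ⟨fun i => (p1RefCell_subset_cube hp i).1, fun i => (p1RefCell_subset_cube hp i).2⟩

/-! ## The pure cube moment by layer cake -/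

/-- The one-dimensional integral `∫₀¹ (1−t)³·t²/2 dt = 1/120`. -/
theorem integral_layercake_aux : ∫ t in (0:ℝ)..1, (1 - t) ^ 3 * (3 * t ^ 2) / 6 = 1 / 120 := by
  have e : ∀ t : ℝ, (1 - t) ^ 3 * (3 * t ^ 2) / 6 = (1/2) * t ^ 2 - (3/2) * t ^ 3 + (3/2) * t ^ 4 - (1/2) * t ^ 5 := fun t => by ring
  simp_rw [e]
  rw [intervalIntegral.integral_sub, intervalIntegral.integral_add, intervalIntegral.integral_sub,
    intervalIntegral.integral_const_mul, intervalIntegral.integral_const_mul, intervalIntegral.integral_const_mul,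
    intervalIntegral.integral_const_mul, integral_pow, integral_pow, integral_pow, integral_pow]
  · norm_num
  all_goals
    first
    | exact ((continuous_const.mul (continuous_pow _)).sub (continuous_const.mul (continuous_pow _))).intervalIntegrable _ _
    | exact (continuous_const.mul (continuous_pow _)).intervalIntegrable _ _
    | exact (((continuous_const.mul (continuous_pow _)).sub (continuous_const.mul (continuous_pow _))).add
        (continuous_const.mul (continuous_pow _))).intervalIntegrable _ _

/-- **`∫_K λ₀³ = 1/120 = |K|/20`** (layer cake). NOT a proof of H12⋆, NOT summit progress. -/
theorem setIntegral_p1Bary_cube_corner :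
    ∫ p in p1RefCell true 0, p1Bary true 0 0 p ^ 3 = 1 / 120 := by
  set K := p1RefCell true 0 with hK
  have hKm : MeasurableSet K := (isClosed_p1RefCell true 0).measurableSet
  set μ : Measure (Fin 3 → ℝ) := volume.restrict K with hμ
  have hbc : Continuous (p1Bary true 0 0) := continuous_p1Bary true 0 0
  have hb0 : 0 ≤ᵐ[μ] p1Bary true 0 0 := by
    rw [hμ]; filter_upwards [ae_restrict_mem hKm] with p hp using hp 0
  -- layer cake with g(t) = 3 t²
  have hlc := lintegral_comp_eq_lintegral_meas_le_mul μ (f := p1Bary true 0 0) (g := fun t => 3 * t ^ 2) hb0 hbc.measurable.aemeasurable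
    (fun T _ => (continuous_const.mul (continuous_pow 2)).intervalIntegrable _ _) (ae_of_all _ fun t => by positivity)
  -- left side: ∫₀^{λ₀} 3t² = λ₀³
  have hL : (fun p => ENNReal.ofReal (∫ t in (0:ℝ)..p1Bary true 0 0 p, 3 * t ^ 2)) = fun p => ENNReal.ofReal (p1Bary true 0 0 p ^ 3) := by
    funext p
    rw [intervalIntegral.integral_const_mul, integral_pow]; ring_nf
  rw [hL] at hlc
  -- right side: the measure of the super-level sets
  have hR : ∀ t ∈ Ioi (0:ℝ), μ {p | t ≤ p1Bary true 0 0 p} * ENNReal.ofReal (3 * t ^ 2) =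
      (Ioc (0:ℝ) 1).indicator (fun t => ENNReal.ofReal ((1 - t) ^ 3 * (3 * t ^ 2) / 6)) t := by
    intro t ht
    have hmeas : MeasurableSet {p : Fin 3 → ℝ | t ≤ p1Bary true 0 0 p} := measurableSet_le measurable_const hbc.measurable
    rw [hμ, Measure.restrict_apply hmeas, inter_comm]
    by_cases h1 : t ≤ 1
    · rw [indicator_of_mem (show t ∈ Ioc (0:ℝ) 1 from ⟨ht, h1⟩), volume_p1RefCell_inter_bary_ge (le_of_lt ht) h1,
        ← ENNReal.ofReal_mul (by positivity)]
      congr 1; ring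
    · have h1' : 1 < t := not_le.1 h1
      rw [indicator_of_notMem (fun h => h1 h.2), volume_p1RefCell_inter_bary_ge_of_one_lt h1', zero_mul]
  have hRint : ∫⁻ t in Ioi (0:ℝ), μ {p | t ≤ p1Bary true 0 0 p} * ENNReal.ofReal (3 * t ^ 2) = ENNReal.ofReal (1 / 120) := by
    rw [setLIntegral_congr_fun measurableSet_Ioi hR, lintegral_indicator measurableSet_Ioc, Measure.restrict_restrict measurableSet_Ioc,
      Ioc_inter_Ioi, max_self]
    have hgc : Continuous fun t : ℝ => (1 - t) ^ 3 * (3 * t ^ 2) / 6 := by fun_prop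
    have hg0 : ∀ t ∈ Ioc (0:ℝ) 1, 0 ≤ (1 - t) ^ 3 * (3 * t ^ 2) / 6 := fun t ht => by
      have : 0 ≤ 1 - t := by linarith [ht.2]
      positivity
    rw [← ofReal_integral_eq_lintegral_ofReal hgc.integrableOn_Ioc ((ae_restrict_iff' measurableSet_Ioc).2 (ae_of_all _ hg0)),
      ← intervalIntegral.integral_of_le zero_le_one, integral_layercake_aux]
  rw [hRint] at hlc
  -- back to the Bochner integral
  have hnn : 0 ≤ᵐ[μ] fun p => p1Bary true 0 0 p ^ 3 := by
    filter_upwards [hb0] with p hp using pow_nonneg hp 3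
  have hint : Integrable (fun p => p1Bary true 0 0 p ^ 3) μ := by
    rw [hμ]
    exact ((hbc.pow 3).continuousOn.integrableOn_compact isCompact_p1RefCell_corner).integrable
  have := integral_eq_lintegral_of_nonneg_ae hnn hint.aestronglyMeasurable
  rw [this, hlc, ENNReal.toReal_ofReal (by norm_num)]

/-! ## Reductions and the mixed third moments -/

/-- Integrability of triple products of barycentric coordinates on `K`. -/
theorem integrableOn_p1Bary_mul3 (i j k : Fin 4) :
    IntegrableOn (fun p => p1Bary true 0 i p * p1Bary true 0 j p * p1Bary true 0 k p) (p1RefCell true 0) volume := by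
  have hc : Continuous fun p : Fin 3 → ℝ => p1Bary true 0 i p * p1Bary true 0 j p * p1Bary true 0 k p := by unfold p1Bary; fun_prop
  exact hc.continuousOn.integrableOn_compact isCompact_p1RefCell_corner

/-- Cyclic symmetry of the third moments: `∫ λ_{i+1}λ_{j+1}λ_{k+1} = ∫ λ_iλ_jλ_k`. -/
theorem setIntegral_p1Bary_mul3_succ (i j k : Fin 4) :
    ∫ p in p1RefCell true 0, p1Bary true 0 (i + 1) p * p1Bary true 0 (j + 1) p * p1Bary true 0 (k + 1) p =
      ∫ p in p1RefCell true 0, p1Bary true 0 i p * p1Bary true 0 j p * p1Bary true 0 k p :=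
  (setIntegral_corner_transport measurePreserving_p1Cyc p1Cyc_mem_iff
    (g := fun q => p1Bary true 0 (i + 1) q * p1Bary true 0 (j + 1) q * p1Bary true 0 (k + 1) q)
    (fun p => by simp only [p1Bary_p1Cyc]) (integrableOn_p1Bary_mul3 _ _ _)).symm

/-- `λ_{σ m}(τ p) = λ_m(p)` for the coordinate swap `τ` and the transposition `σ = (1 2)` of the vertex labels. -/
theorem p1Bary_p1Sw_swap (m : Fin 4) (p : Fin 3 → ℝ) : p1Bary true 0 (Equiv.swap (1 : Fin 4) 2 m) (p1SwapLin p) = p1Bary true 0 m p := by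
  fin_cases m
  · exact p1Bary_p1Swap_zero p
  · exact p1Bary_p1Swap_two p
  · exact p1Bary_p1Swap_one p
  · exact p1Bary_p1Swap_three p

/-- Swap symmetry of the third moments: `∫ λ_{σi}λ_{σj}λ_{σk} = ∫ λ_iλ_jλ_k`, `σ = (1 2)`. -/
theorem setIntegral_p1Bary_mul3_swap (i j k : Fin 4) :
    ∫ p in p1RefCell true 0, p1Bary true 0 (Equiv.swap (1 : Fin 4) 2 i) p * p1Bary true 0 (Equiv.swap (1 : Fin 4) 2 j) p *
        p1Bary true 0 (Equiv.swap (1 : Fin 4) 2 k) p =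
      ∫ p in p1RefCell true 0, p1Bary true 0 i p * p1Bary true 0 j p * p1Bary true 0 k p :=
  (setIntegral_corner_transport measurePreserving_p1Swap p1Swap_mem_iff
    (g := fun q => p1Bary true 0 (Equiv.swap (1 : Fin 4) 2 i) q * p1Bary true 0 (Equiv.swap (1 : Fin 4) 2 j) q *
      p1Bary true 0 (Equiv.swap (1 : Fin 4) 2 k) q)
    (fun p => by simp only [p1Bary_p1Sw_swap]) (integrableOn_p1Bary_mul3 _ _ _)).symm

/-- Reduction by the partition of unity: `∫ λ_iλ_j = Σ_m ∫ λ_iλ_jλ_m`. -/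
theorem setIntegral_p1Bary_mul_eq_sum_mul3 (i j : Fin 4) :
    ∫ p in p1RefCell true 0, p1Bary true 0 i p * p1Bary true 0 j p =
      ∑ m : Fin 4, ∫ p in p1RefCell true 0, p1Bary true 0 i p * p1Bary true 0 j p * p1Bary true 0 m p := by
  rw [← integral_finsetSum _ fun m _ => integrableOn_p1Bary_mul3 i j m]
  refine setIntegral_congr_fun (isClosed_p1RefCell true 0).measurableSet fun p _ => ?_
  rw [← Finset.mul_sum, sum_p1Bary_eq_one true 0 p, mul_one]

/-- **`∫_K λ₀²λ₁ = 1/360`** (hence, by the symmetries, every `∫_K λ_i²λ_j`, `i ≠ j`).  NOT a proof of H12⋆, NOT summit progress. -/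
theorem setIntegral_p1Bary_sq_mul_corner :
    ∫ p in p1RefCell true 0, p1Bary true 0 0 p * p1Bary true 0 0 p * p1Bary true 0 1 p = 1 / 360 := by
  have hmeas : MeasurableSet (p1RefCell true 0) := (isClosed_p1RefCell true 0).measurableSet
  -- M(0,0,0) = 1/120
  have h000 : ∫ p in p1RefCell true 0, p1Bary true 0 0 p * p1Bary true 0 0 p * p1Bary true 0 0 p = 1 / 120 := by
    rw [← setIntegral_p1Bary_cube_corner]
    exact setIntegral_congr_fun hmeas fun p _ => by ring
  -- M(0,0,2) = M(0,0,1)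
  have h002 : ∫ p in p1RefCell true 0, p1Bary true 0 0 p * p1Bary true 0 0 p * p1Bary true 0 2 p =
      ∫ p in p1RefCell true 0, p1Bary true 0 0 p * p1Bary true 0 0 p * p1Bary true 0 1 p := by
    simpa [Equiv.swap_apply_def] using setIntegral_p1Bary_mul3_swap 0 0 1
  -- M(0,0,3) = M(0,0,1) through (3,3,2), (3,3,1), (2,2,0), (1,1,0), (2,2,1), (1,1,2)
  have ha : ∫ p in p1RefCell true 0, p1Bary true 0 0 p * p1Bary true 0 0 p * p1Bary true 0 3 p =
      ∫ p in p1RefCell true 0, p1Bary true 0 3 p * p1Bary true 0 3 p * p1Bary true 0 2 p := by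
    simpa using setIntegral_p1Bary_mul3_succ 3 3 2
  have hb : ∫ p in p1RefCell true 0, p1Bary true 0 3 p * p1Bary true 0 3 p * p1Bary true 0 2 p =
      ∫ p in p1RefCell true 0, p1Bary true 0 3 p * p1Bary true 0 3 p * p1Bary true 0 1 p := by
    simpa [Equiv.swap_apply_def] using setIntegral_p1Bary_mul3_swap 3 3 1
  have hc : ∫ p in p1RefCell true 0, p1Bary true 0 3 p * p1Bary true 0 3 p * p1Bary true 0 1 p =
      ∫ p in p1RefCell true 0, p1Bary true 0 2 p * p1Bary true 0 2 p * p1Bary true 0 0 p := by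
    simpa using setIntegral_p1Bary_mul3_succ 2 2 0
  have hd : ∫ p in p1RefCell true 0, p1Bary true 0 2 p * p1Bary true 0 2 p * p1Bary true 0 0 p =
      ∫ p in p1RefCell true 0, p1Bary true 0 1 p * p1Bary true 0 1 p * p1Bary true 0 0 p := by
    simpa [Equiv.swap_apply_def] using setIntegral_p1Bary_mul3_swap 1 1 0
  have he : ∫ p in p1RefCell true 0, p1Bary true 0 2 p * p1Bary true 0 2 p * p1Bary true 0 1 p =
      ∫ p in p1RefCell true 0, p1Bary true 0 1 p * p1Bary true 0 1 p * p1Bary true 0 0 p := by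
    simpa using setIntegral_p1Bary_mul3_succ 1 1 0
  have hf : ∫ p in p1RefCell true 0, p1Bary true 0 2 p * p1Bary true 0 2 p * p1Bary true 0 1 p =
      ∫ p in p1RefCell true 0, p1Bary true 0 1 p * p1Bary true 0 1 p * p1Bary true 0 2 p := by
    simpa [Equiv.swap_apply_def] using setIntegral_p1Bary_mul3_swap 1 1 2
  have hg : ∫ p in p1RefCell true 0, p1Bary true 0 1 p * p1Bary true 0 1 p * p1Bary true 0 2 p =
      ∫ p in p1RefCell true 0, p1Bary true 0 0 p * p1Bary true 0 0 p * p1Bary true 0 1 p := by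
    simpa using setIntegral_p1Bary_mul3_succ 0 0 1
  -- reduction: 1/60 = ∫λ₀² = Σ_m M(0,0,m)
  have hred := setIntegral_p1Bary_mul_eq_sum_mul3 0 0
  rw [setIntegral_p1Bary_sq_corner 0] at hred
  simp only [Fin.sum_univ_four] at hred
  linarith

/-- **`∫_K λ₀λ₁λ₂ = 1/720`** (hence every `∫_K λ_iλ_jλ_k` with distinct indices).  NOT a proof of H12⋆, NOT summit progress. -/
theorem setIntegral_p1Bary_triple_corner :
    ∫ p in p1RefCell true 0, p1Bary true 0 0 p * p1Bary true 0 1 p * p1Bary true 0 2 p = 1 / 720 := by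
  have hmeas : MeasurableSet (p1RefCell true 0) := (isClosed_p1RefCell true 0).measurableSet
  have h001 := setIntegral_p1Bary_sq_mul_corner
  -- M(0,1,0) = M(0,0,1), M(0,1,1) = M(1,1,0) = M(0,0,1)
  have h010 : ∫ p in p1RefCell true 0, p1Bary true 0 0 p * p1Bary true 0 1 p * p1Bary true 0 0 p = 1 / 360 := by
    rw [← h001]; exact setIntegral_congr_fun hmeas fun p _ => by ring
  have ha : ∫ p in p1RefCell true 0, p1Bary true 0 0 p * p1Bary true 0 0 p * p1Bary true 0 3 p =
      ∫ p in p1RefCell true 0, p1Bary true 0 3 p * p1Bary true 0 3 p * p1Bary true 0 2 p := by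
    simpa using setIntegral_p1Bary_mul3_succ 3 3 2
  have hb : ∫ p in p1RefCell true 0, p1Bary true 0 3 p * p1Bary true 0 3 p * p1Bary true 0 2 p =
      ∫ p in p1RefCell true 0, p1Bary true 0 3 p * p1Bary true 0 3 p * p1Bary true 0 1 p := by
    simpa [Equiv.swap_apply_def] using setIntegral_p1Bary_mul3_swap 3 3 1
  have hc : ∫ p in p1RefCell true 0, p1Bary true 0 3 p * p1Bary true 0 3 p * p1Bary true 0 1 p =
      ∫ p in p1RefCell true 0, p1Bary true 0 2 p * p1Bary true 0 2 p * p1Bary true 0 0 p := by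
    simpa using setIntegral_p1Bary_mul3_succ 2 2 0
  have hd : ∫ p in p1RefCell true 0, p1Bary true 0 2 p * p1Bary true 0 2 p * p1Bary true 0 0 p =
      ∫ p in p1RefCell true 0, p1Bary true 0 1 p * p1Bary true 0 1 p * p1Bary true 0 0 p := by
    simpa [Equiv.swap_apply_def] using setIntegral_p1Bary_mul3_swap 1 1 0
  have h002 : ∫ p in p1RefCell true 0, p1Bary true 0 0 p * p1Bary true 0 0 p * p1Bary true 0 2 p =
      ∫ p in p1RefCell true 0, p1Bary true 0 0 p * p1Bary true 0 0 p * p1Bary true 0 1 p := by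
    simpa [Equiv.swap_apply_def] using setIntegral_p1Bary_mul3_swap 0 0 1
  have h000 : ∫ p in p1RefCell true 0, p1Bary true 0 0 p * p1Bary true 0 0 p * p1Bary true 0 0 p = 1 / 120 := by
    rw [← setIntegral_p1Bary_cube_corner]
    exact setIntegral_congr_fun hmeas fun p _ => by ring
  have hred0 := setIntegral_p1Bary_mul_eq_sum_mul3 0 0
  rw [setIntegral_p1Bary_sq_corner 0] at hred0
  simp only [Fin.sum_univ_four] at hred0
  -- hence M(1,1,0) = M(0,0,3) = 1/360
  have h110 : ∫ p in p1RefCell true 0, p1Bary true 0 1 p * p1Bary true 0 1 p * p1Bary true 0 0 p = 1 / 360 := by linarith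
  have h011 : ∫ p in p1RefCell true 0, p1Bary true 0 0 p * p1Bary true 0 1 p * p1Bary true 0 1 p = 1 / 360 := by
    rw [← h110]; exact setIntegral_congr_fun hmeas fun p _ => by ring
  -- M(0,1,3) = M(0,1,2): shift (3,0,1) -> (0,1,2)
  have hs : ∫ p in p1RefCell true 0, p1Bary true 0 0 p * p1Bary true 0 1 p * p1Bary true 0 2 p =
      ∫ p in p1RefCell true 0, p1Bary true 0 3 p * p1Bary true 0 0 p * p1Bary true 0 1 p := by
    simpa using setIntegral_p1Bary_mul3_succ 3 0 1
  have h013 : ∫ p in p1RefCell true 0, p1Bary true 0 0 p * p1Bary true 0 1 p * p1Bary true 0 3 p =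
      ∫ p in p1RefCell true 0, p1Bary true 0 0 p * p1Bary true 0 1 p * p1Bary true 0 2 p := by
    rw [hs]; exact setIntegral_congr_fun hmeas fun p _ => by ring
  -- reduction: 1/120 = ∫λ₀λ₁ = Σ_m M(0,1,m)
  have hred := setIntegral_p1Bary_mul_eq_sum_mul3 0 1
  rw [setIntegral_p1Bary_mul_corner (show (0 : Fin 4) ≠ 1 by decide)] at hred
  simp only [Fin.sum_univ_four] at hred
  linarith

end Summit.AtomisticToContinuum.Crystallization.Theorems.StrictSplittingRuleBirth

end
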